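import Summits.QuantumFields.BalabanUV.Beta.ModeSum
import Summits.QuantumFields.BalabanUV.Beta.AliasBlock

/-!
# Beta / SaddleInverseModes — the two structural hypotheses of `Beta/SaddleInverse` (`A N = 0`, `A G = 1 − Y L`) DISCHARGED for
# every mode-diagonal block `A = Σ_t E_t N_t F_t` with alias blocks `N_t = L_t·1 − ∂_t ⊗ ∂♭_t` over ANY biorthogonal complete family
# `(E_t, F_t)`: explicit kernel frame, cokernel frame, group inverse `G = Σ_t E_t (c_t² N_t) F_t` and defect `1 − A G = Y ∂♭ᵀF`
# (β sub-cell, CAP lane «KERNEL ALGEBRA + EXPORT», lineage `b2b-balaban-beta-cap3`, gen 10; wiring of `Beta/ModeSum` + `Beta/AliasBlock`)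

WHY.  `Beta/SaddleInverse.inv_saddle_eq_pairingInv` and `Beta/SaddleInverseResidual.saddle_mul_pairingInv_eq_one_add` are stated over
abstract matrices with hypotheses `hAN : A * N = 0`, `hAG : A * G = 1 − Y * L` (plus the Faddeev–Popov products, which are the
engines' business).  For the cell's block `A` (CAP-KERNEL §4.15: the gauge-NON-fixed quadratic form on one block, mode-diagonal in the
alias characters) this leaf constructs `N`, `L`, `G`, `Y` EXPLICITLY and PROVES both hypotheses from per-mode facts only:
`Beta/ModeSum` (biorthogonal mode sums) and `Beta/AliasBlock` (`N_t ∂_t = 0`, `∂♭_tᵀ N_t = 0`, `N_t (c_t² N_t) = 1 − (c_t ∂_t) ⊗ ∂♭_t`).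
What is left for a concrete instance is DEFINITIONAL: choose `E_t`, `F_t` (the alias characters, `Beta/AliasCharacters`, twisted by the
quasi-momentum through `ModeSum.Biorth.similar`) and `∂_t`, `∂♭_t`, `L_t` (`GAN24/AliasObjects.dAl` ∕ `dbAl` ∕ `LAl`, with
`AliasObjects.dot_dbAl_dAl`), and `c_t = L_t⁻¹` on the regular zone.  [folklore] matrix algebra; nothing of the imported leaves re-proved.

## What is proved (`ι` modes, `n` bonds, `a` directions — finite types with decidable equality; `R` a commutative ring;
data `E : ι → Matrix n a R`, `F : ι → Matrix a n R`, `dd db : ι → a → R`, `L c : ι → R`; hypotheses `Biorth E F`, `Σ_t E_t F_t = 1`,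
`∀ t, db t ⬝ᵥ dd t = L t`, `∀ t, c t * L t = 1` where stated)
* §1 defs `aOp` (`A = Σ_t E_t N_t F_t`), `kerFrame` (column `t` = `E_t ∂_t`), `cokerFrame` (row `t` = `∂♭_tᵀ F_t`), `gOp` (`G = Σ_t E_t (c_t² N_t) F_t`),
  `yFrame` (column `t` = `E_t (c_t ∂_t)`); `yFrame_eq_kerFrame_mul_diagonal` (`Y = N · diag c`).
* §2 **`aOp_mul_kerFrame : A * kerFrame = 0`** and **`cokerFrame_mul_aOp : cokerFrame * A = 0`** (the hypotheses `hAN`, and `L A = 0`).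
* §3 `yFrame_mul_cokerFrame : Y * cokerFrame = Σ_t E_t ((c_t ∂_t) ⊗ ∂♭_t) F_t`, **`aOp_mul_gOp : A * G = 1 − Y * cokerFrame`** (the hypothesis
  `hAG`), and the group-inverse relations `aOp_mul_gOp_mul_aOp : A G A = A`, `gOp_mul_aOp_mul_gOp : G A G = G`, `aOp_mul_gOp_comm : A G = G A`.

HONEST FRAMING.  Finite-dimensional matrix identities, [folklore]; no estimate, no cited fact, no number.  This module proves NO bound on any
object of the cell, NO number of the β-function, NO statement about Bałaban's operators and discharges NOTHING of `FlowStep.BetaPertH`; it is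
not an engine and not the concrete `408 × 408` instance.  Discharging `BetaPertH` would make Bałaban's ultraviolet stability unconditional —
NOT the continuum limit and NOT the Clay problem.  0 `sorry`, 0 cite tags; imports `Beta/ModeSum` and `Beta/AliasBlock` only.
-/

namespace Summit.QuantumFields.BalabanUV.Beta.SaddleInverseModes

open Matrix
open ModeSum (modeSum Biorth)
open AliasBlock (nMat nMat_mulVec_dd db_vecMul_nMat nMat_mul_pinv nMat_groupInverse₁ nMat_groupInverse₂)

variable {ι n a R : Type*} [CommRing R]

/-! ## §1 The objects -/

section Defs

variable [Fintype ι] [Fintype a] [DecidableEq a]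

/-- The mode-diagonal block `A = Σ_t E_t N_t F_t` with alias blocks `N_t = L_t·1 − ∂_t ⊗ ∂♭_t`. -/
def aOp (E : ι → Matrix n a R) (F : ι → Matrix a n R) (dd db : ι → a → R) (L : ι → R) : Matrix n n R :=
  modeSum E F fun t => nMat (dd t) (db t) (L t)

/-- The explicit GROUP INVERSE `G = Σ_t E_t (c_t² N_t) F_t` (`c_t L_t = 1`). -/
def gOp (E : ι → Matrix n a R) (F : ι → Matrix a n R) (dd db : ι → a → R) (L c : ι → R) : Matrix n n R :=
  modeSum E F fun t => (c t ^ 2) • nMat (dd t) (db t) (L t)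

end Defs

section Frames

variable [Fintype a]

/-- The KERNEL FRAME: column `t` is the pure-gauge direction `E_t ∂_t` of mode `t`. -/
def kerFrame (E : ι → Matrix n a R) (dd : ι → a → R) : Matrix n ι R :=
  Matrix.of fun b t => (E t *ᵥ dd t) b

/-- The COKERNEL FRAME: row `t` is `∂♭_tᵀ F_t`. -/
def cokerFrame (F : ι → Matrix a n R) (db : ι → a → R) : Matrix ι n R :=
  Matrix.of fun t b => (db t ᵥ* F t) b

/-- The scaled kernel frame `Y`: column `t` is `E_t (c_t ∂_t)`. -/
def yFrame (E : ι → Matrix n a R) (dd : ι → a → R) (c : ι → R) : Matrix n ι R :=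
  Matrix.of fun b t => (E t *ᵥ (c t • dd t)) b

/-- [folklore] `Y = kerFrame · diag c`. -/
theorem yFrame_eq_kerFrame_mul_diagonal [Fintype ι] [DecidableEq ι] (E : ι → Matrix n a R) (dd : ι → a → R) (c : ι → R) :
    yFrame E dd c = kerFrame E dd * Matrix.diagonal c := by
  ext b t
  rw [Matrix.mul_diagonal]
  simp [yFrame, kerFrame, Matrix.mulVec_smul, mul_comm]

end Frames

section Main

variable [Fintype ι] [Fintype n] [Fintype a] [DecidableEq ι] [DecidableEq a]
variable {E : ι → Matrix n a R} {F : ι → Matrix a n R} {dd db : ι → a → R} {L c : ι → R}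

/-! ## §2 Kernel and cokernel: `A · kerFrame = 0`, `cokerFrame · A = 0` -/

/-- [folklore] `A (E_t ∂_t) = E_t (N_t ∂_t) = 0`: the kernel frame is killed (hypothesis `hAN : A * N = 0` of `Beta/SaddleInverse`). -/
theorem aOp_mul_kerFrame (hEF : Biorth E F) (h : ∀ t, db t ⬝ᵥ dd t = L t) :
    aOp E F dd db L * kerFrame E dd = 0 := by
  ext b t
  change (aOp E F dd db L *ᵥ (E t *ᵥ dd t)) b = 0
  rw [Matrix.mulVec_mulVec, aOp, hEF.modeSum_mul_E, ← Matrix.mulVec_mulVec, nMat_mulVec_dd (h t), Matrix.mulVec_zero]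
  rfl

/-- [folklore] `(∂♭_tᵀ F_t) A = (∂♭_tᵀ N_t) F_t = 0`: the cokernel frame kills `A` on the left (`L A = 0`). -/
theorem cokerFrame_mul_aOp (hEF : Biorth E F) (h : ∀ t, db t ⬝ᵥ dd t = L t) :
    cokerFrame F db * aOp E F dd db L = 0 := by
  ext t b
  change ((db t ᵥ* F t) ᵥ* aOp E F dd db L) b = 0
  rw [Matrix.vecMul_vecMul, aOp, hEF.F_mul_modeSum, ← Matrix.vecMul_vecMul, db_vecMul_nMat (h t), Matrix.zero_vecMul]
  rfl

/-! ## §3 The group inverse and the defect `1 − A G = Y · cokerFrame` -/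

omit [Fintype n] [DecidableEq ι] [DecidableEq a] in
/-- [folklore] `Y · cokerFrame = Σ_t E_t ((c_t ∂_t) ⊗ ∂♭_t) F_t`. -/
theorem yFrame_mul_cokerFrame (E : ι → Matrix n a R) (F : ι → Matrix a n R) (dd db : ι → a → R) (c : ι → R) :
    yFrame E dd c * cokerFrame F db = modeSum E F fun t => vecMulVec (c t • dd t) (db t) := by
  ext b b'
  rw [Matrix.mul_apply]
  unfold modeSum
  rw [Matrix.sum_apply]
  refine Finset.sum_congr rfl fun t _ => ?_
  rw [Matrix.mul_vecMulVec, Matrix.vecMulVec_mul, vecMulVec_apply]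
  rfl

/-- [folklore] THE DEFECT IDENTITY `A G = 1 − Y · cokerFrame` (hypothesis `hAG : A * G = 1 − Y * L` of `Beta/SaddleInverse`, with
`L := cokerFrame`), from completeness `Σ_t E_t F_t = 1` and `N_t (c_t² N_t) = 1 − (c_t ∂_t) ⊗ ∂♭_t`. -/
theorem aOp_mul_gOp [DecidableEq n] (hEF : Biorth E F) (hcpl : ∑ t, E t * F t = 1) (h : ∀ t, db t ⬝ᵥ dd t = L t)
    (hcL : ∀ t, c t * L t = 1) :
    aOp E F dd db L * gOp E F dd db L c = 1 - yFrame E dd c * cokerFrame F db := by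
  have h1 := hEF.one_sub_modeSum_mul hcpl (fun t => nMat (dd t) (db t) (L t))
    (fun t => (c t ^ 2) • nMat (dd t) (db t) (L t))
  have h2 : (modeSum E F fun t => 1 - nMat (dd t) (db t) (L t) * ((c t ^ 2) • nMat (dd t) (db t) (L t)))
      = yFrame E dd c * cokerFrame F db := by
    rw [yFrame_mul_cokerFrame]
    congr 1
    funext t
    rw [nMat_mul_pinv (h t) (hcL t), sub_sub_cancel]
  unfold aOp gOp
  rw [← h2, ← h1, sub_sub_cancel]

/-- [folklore] `A G A = A`. -/
theorem aOp_mul_gOp_mul_aOp (hEF : Biorth E F) (h : ∀ t, db t ⬝ᵥ dd t = L t) (hcL : ∀ t, c t * L t = 1) :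
    aOp E F dd db L * gOp E F dd db L c * aOp E F dd db L = aOp E F dd db L :=
  (hEF.groupInverse (fun t => nMat_groupInverse₁ (h t) (hcL t)) (fun t => nMat_groupInverse₂ (h t) (hcL t))
    (fun t => by rw [Matrix.mul_smul, Matrix.smul_mul])).1

/-- [folklore] `G A G = G`. -/
theorem gOp_mul_aOp_mul_gOp (hEF : Biorth E F) (h : ∀ t, db t ⬝ᵥ dd t = L t) (hcL : ∀ t, c t * L t = 1) :
    gOp E F dd db L c * aOp E F dd db L * gOp E F dd db L c = gOp E F dd db L c :=
  (hEF.groupInverse (fun t => nMat_groupInverse₁ (h t) (hcL t)) (fun t => nMat_groupInverse₂ (h t) (hcL t))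
    (fun t => by rw [Matrix.mul_smul, Matrix.smul_mul])).2.1

/-- [folklore] `A G = G A`. -/
theorem aOp_mul_gOp_comm (hEF : Biorth E F) (h : ∀ t, db t ⬝ᵥ dd t = L t) (hcL : ∀ t, c t * L t = 1) :
    aOp E F dd db L * gOp E F dd db L c = gOp E F dd db L c * aOp E F dd db L :=
  (hEF.groupInverse (fun t => nMat_groupInverse₁ (h t) (hcL t)) (fun t => nMat_groupInverse₂ (h t) (hcL t))
    (fun t => by rw [Matrix.mul_smul, Matrix.smul_mul])).2.2

end Main

end Summit.QuantumFields.BalabanUV.Beta.SaddleInverseModes
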